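import Literature.AnabelianGeometry.AbsoluteAnabelian.MLFGaloisGroups
import Literature.AnabelianGeometry.AbsoluteAnabelian.ProfiniteTerminology
import Mathlib.FieldTheory.KrullTopology
import Mathlib.Topology.Algebra.OpenSubgroup
import Mathlib.RingTheory.Valuation.LocalSubring
import HarnessLib

/-!
# [AbsAnab] Remark 0.1.2 (second implication) and Thm 1.1.1 (ii): relative slimness of
# `G_𝔭 ↪ G_F` from commensurable terminality and slimness — the printed deduction

S. Mochizuki, *The Absolute Anabelian Geometry of Hyperbolic Curves* (2004) [AbsAnab]
(manuscript pagination, lit key paper:url-e8f118cc205e):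

* Remark 0.1.2 p. 4: "It is a formal consequence of the definitions that [...] (if `H ⊆ G` is a
  closed subgroup of a profinite group `G`, then): `H ⊆ G` commensurably terminal, `H` slim
  `⟹` the inclusion `H ↪ G` is relatively slim."  PROVED here
  (`isRelativelySlim_subtype_of_isCommensurablyTerminal_of_isSlimGroup`; the statement file
  `ProfiniteTerminology.lean` proves the other three sentences of Remarks 0.1.1–0.1.3 and
  leaves this one "for a later pass").
* Thm 1.1.1 (ii) p. 6, proof: "Relative slimness thus follows formally from the slimness of
  `G_𝔭` and (i) (cf. Remark 0.1.2)."  Kernel-checked here as the CONDITIONAL discharge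
  `galoisNF_decomposition_relativelySlim_of_commensurablyTerminal_of_slim`: the named fact
  `galoisNF_decomposition_relativelySlim` of `MLFGaloisGroups.lean` follows from the named fact
  `galoisNF_decomposition_commensurablyTerminal` (Thm 1.1.1 (i), "[NSW] Cor. 12.1.3") and the
  slimness of the decomposition groups `G_𝔭` (Thm 1.1.1 (ii) local half, "local class field
  theory"; kept as the explicit hypothesis `hslim` — it is `galoisMLF_slim` transported along
  `G_𝔭 ≅ G_{F_𝔭}`, FOUNDATIONS row 15).  Ingredient proved here: `G_𝔭 ⊆ G_F` is closed
  (the stabiliser of a valuation ring of `F̄` in the Krull topology).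

Proof-only: no definition is introduced; nothing of the statement files is restated.
HONEST FRAMING: nothing here bears on [IUTchIII] Cor. 3.12.
-/

noncomputable section

namespace Literature.AnabelianGeometry.AbsoluteAnabelian

open Field
open Literature.AlgebraicGeometry.Frobenioids (IsSlimGroup)
open scoped Pointwise

universe u

/-! ### [AbsAnab] Remark 0.1.2, second implication -/

section Remark012

variable {G : Type u} [Group G] [TopologicalSpace G] [IsTopologicalGroup G] [CompactSpace G]

/-- **[AbsAnab] Remark 0.1.2, second implication**, PROVED: if `H ⊆ G` is a closed subgroup of
a compact (e.g. profinite) group `G` which is commensurably terminal and slim, then the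
inclusion `H ↪ G` is relatively slim.  (Argument: if `g` centralises an open subgroup
`U ⊆ H`, then `U ⊆ H ∩ gHg⁻¹` has finite index in `H` and in `gHg⁻¹ ⊇ gUg⁻¹ = U`, so
`g ∈ C_G(H) = H`, and then `g ∈ Z_H(U) = 1`.) [cite: MochizukiAbsAnab2004, Rem 0.1.2 p.4] -/
theorem isRelativelySlim_subtype_of_isCommensurablyTerminal_of_isSlimGroup (H : Subgroup G)
    (hH : IsClosed (H : Set G)) (hct : IsCommensurablyTerminal H) (hslim : IsSlimGroup H) :
    IsRelativelySlim H.subtype := by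
  haveI : CompactSpace H := isCompact_iff_compactSpace.mp hH.isCompact
  refine ⟨fun U hU => ?_⟩
  rw [eq_bot_iff]
  intro g hg
  rw [Subgroup.mem_centralizer_iff] at hg
  -- `U` has finite index in `H`
  haveI : Finite (H ⧸ U) := Subgroup.quotient_finite_of_isOpen U hU
  have hUidx : U.index ≠ 0 := Subgroup.index_ne_zero_of_finite
  -- `U' ⊆ G`, the image of `U`; `g` centralises it
  set U' : Subgroup G := U.map H.subtype with hU'
  have hU'le : U' ≤ H := Subgroup.map_subtype_le U
  have hgu : ∀ u ∈ U', g * u * g⁻¹ = u := by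
    rintro _ ⟨u, hu, rfl⟩
    rw [(hg (H.subtype u) ⟨u, hu, rfl⟩).symm, mul_inv_cancel_right]
  have hrel : U'.relIndex H = U.index := by
    change (Subgroup.comap H.subtype (Subgroup.map H.subtype U)).index = U.index
    rw [Subgroup.comap_map_eq_self_of_injective H.subtype_injective]
  -- conjugation by `g` fixes `U'`
  set c : ConjAct G := ConjAct.toConjAct g with hc
  have hsmul : ∀ x : G, c⁻¹ • x = g⁻¹ * x * g := fun x => by
    rw [hc, ← ConjAct.toConjAct_inv, ConjAct.smul_def, ConjAct.ofConjAct_toConjAct, inv_inv]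
  have hfix : c • U' = U' := by
    ext x
    rw [Subgroup.mem_pointwise_smul_iff_inv_smul_mem, hsmul]
    constructor
    · intro hx
      have h1 := hgu _ hx
      have h2 : g * (g⁻¹ * x * g) * g⁻¹ = x := by group
      rw [h2] at h1
      rw [h1]
      exact hx
    · intro hx
      have h1 := hgu x hx
      have h2 : g⁻¹ * x * g = x :=
        calc g⁻¹ * x * g = g⁻¹ * (g * x * g⁻¹) * g := by rw [h1]
          _ = x := by group
      rw [h2]
      exact hx
  -- hence `g` commensurates `H`
  have hcomm : g ∈ Subgroup.Commensurable.commensurator H := by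
    rw [Subgroup.Commensurable.commensurator_mem_iff, ← hc]
    refine ⟨?_, ?_⟩
    · -- `[H : cHc⁻¹ ∩ H] < ∞` since `U' ≤ cHc⁻¹`
      have hle : U' ≤ c • H := by
        rw [← hfix]
        exact Subgroup.pointwise_smul_le_pointwise_smul_iff.mpr hU'le
      intro h0
      exact hUidx (by
        rw [← hrel]
        exact Subgroup.relIndex_eq_zero_of_le_left hle h0)
    · -- `[cHc⁻¹ : H ∩ cHc⁻¹] < ∞` since `U' = cU'c⁻¹ ≤ cHc⁻¹` has index `[H : U']` there
      intro h0
      have h1 : U'.relIndex (c • H) = 0 := Subgroup.relIndex_eq_zero_of_le_left hU'le h0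
      rw [← hfix, Subgroup.relIndex_pointwise_smul, hrel] at h1
      exact hUidx h1
  rw [hct.commensurator_eq] at hcomm
  -- `g ∈ H` centralises the open subgroup `U` of the slim group `H`
  have hz : (⟨g, hcomm⟩ : H) ∈ Subgroup.centralizer (U : Set H) := by
    rw [Subgroup.mem_centralizer_iff]
    intro u hu
    apply Subtype.ext
    exact hg (H.subtype u) ⟨u, hu, rfl⟩
  rw [hslim.centralizer_eq_bot U hU, Subgroup.mem_bot] at hz
  rw [Subgroup.mem_bot]
  exact congrArg Subtype.val hz

end Remark012

/-! ### The decomposition group `G_𝔭 ⊆ G_F` is closed -/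

section Closed

variable (F : Type) [Field F]

/-- A subset of `Gal(K̄/F)` stable under right multiplication by the fixing subgroup of a
finite subextension is open (Krull topology). [folklore] -/
private theorem isOpen_of_mul_fixingSubgroup (S : Set (AlgebraicClosure F ≃ₐ[F] AlgebraicClosure F))
    (E : IntermediateField F (AlgebraicClosure F)) [FiniteDimensional F E]
    (hS : ∀ σ ∈ S, ∀ τ ∈ E.fixingSubgroup, σ * τ ∈ S) : IsOpen S := by
  rw [isOpen_iff_mem_nhds]
  intro σ hσ
  refine Filter.mem_of_superset ((E.fixingSubgroup_isOpen.leftCoset σ).mem_nhds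
    ⟨1, one_mem _, mul_one σ⟩) ?_
  rintro _ ⟨τ, hτ, rfl⟩
  exact hS σ hσ τ hτ

/-- For `x ∈ F̄` and a valuation subring `A ⊆ F̄`, the set of `σ ∈ Gal(F̄/F)` with
`σ x ∈ A ↔ x ∈ A` is closed. [folklore] -/
private theorem isClosed_setOf_smul_mem_iff (A : ValuationSubring (AlgebraicClosure F))
    (x : AlgebraicClosure F) :
    IsClosed {σ : AlgebraicClosure F ≃ₐ[F] AlgebraicClosure F | σ • x ∈ A ↔ x ∈ A} := by
  haveI : FiniteDimensional F (IntermediateField.adjoin F {x}) :=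
    IntermediateField.adjoin.finiteDimensional (Algebra.IsIntegral.isIntegral x)
  have hτ : ∀ τ ∈ (IntermediateField.adjoin F {x}).fixingSubgroup, τ • x = x := fun τ hτ =>
    (IntermediateField.mem_fixingSubgroup_iff _ _).mp hτ x
      (IntermediateField.mem_adjoin_simple_self F x)
  rw [← isOpen_compl_iff]
  refine isOpen_of_mul_fixingSubgroup F _ (IntermediateField.adjoin F {x}) fun σ hσ τ hτ' => ?_
  simp only [Set.mem_compl_iff, Set.mem_setOf_eq] at hσ ⊢
  rwa [mul_smul, hτ τ hτ']

/-- The decomposition group `G_𝔭 ⊆ G_F` (stabiliser of a valuation ring `A` of `F̄`) is closed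
in the Krull topology. [cite: MochizukiAbsAnab2004, §1.1 p.5] -/
theorem isClosed_decompositionGroupNF (A : ValuationSubring (AlgebraicClosure F)) :
    IsClosed (decompositionGroupNF F A : Set (absoluteGaloisGroup F)) := by
  -- `Field.absoluteGaloisGroup F` is `F̄ ≃ₐ[F] F̄` with the Krull topology
  change IsClosed ((A.decompositionSubgroup F : Subgroup (AlgebraicClosure F ≃ₐ[F]
    AlgebraicClosure F)) : Set (AlgebraicClosure F ≃ₐ[F] AlgebraicClosure F))
  have hrepr : ((A.decompositionSubgroup F : Subgroup (AlgebraicClosure F ≃ₐ[F]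
      AlgebraicClosure F)) : Set (AlgebraicClosure F ≃ₐ[F] AlgebraicClosure F)) =
      ⋂ x : AlgebraicClosure F, {σ | σ • x ∈ A ↔ x ∈ A} := by
    ext σ
    simp only [Set.mem_iInter, SetLike.mem_coe, MulAction.mem_stabilizer_iff, Set.mem_setOf_eq]
    constructor
    · intro h x
      rw [← ValuationSubring.mem_inv_pointwise_smul_iff]
      have hinv : σ⁻¹ • A = A := by rw [inv_smul_eq_iff, h]
      rw [hinv]
    · intro h
      ext x
      rw [ValuationSubring.mem_pointwise_smul_iff_inv_smul_mem, ← h (σ⁻¹ • x), smul_inv_smul]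
  rw [hrepr]
  exact isClosed_iInter fun x => isClosed_setOf_smul_mem_iff F A x

end Closed

/-! ### [AbsAnab] Theorem 1.1.1 (ii), first clause -/

section Thm111

/-- **[AbsAnab] Thm 1.1.1 (ii)**, relative slimness of `G_𝔭 ↪ G_F`, the printed deduction
kernel-checked: GIVEN Thm 1.1.1 (i) (`hct`: `G_𝔭 ⊆ G_F` commensurably terminal, the named
fact `galoisNF_decomposition_commensurablyTerminal`, "[NSW] Cor. 12.1.3") and the slimness of
the decomposition groups `G_𝔭` (`hslim`: "the slimness of `G_𝔭` follows from local class field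
theory"), "relative slimness thus follows formally from the slimness of `G_𝔭` and (i) (cf.
Remark 0.1.2)". [cite: MochizukiAbsAnab2004, Thm 1.1.1 (ii) p.6] -/
theorem galoisNF_decomposition_relativelySlim_of_commensurablyTerminal_of_slim
    (hct : galoisNF_decomposition_commensurablyTerminal)
    (hslim : ∀ (F : Type) [Field F] [NumberField F]
      (A : ValuationSubring (AlgebraicClosure F)), A ≠ ⊤ →
        IsSlimGroup (decompositionGroupNF F A)) :
    galoisNF_decomposition_relativelySlim := by
  intro F _ _ A hA
  exact (isRelativelySlim_subtype_of_isCommensurablyTerminal_of_isSlimGroup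
    (decompositionGroupNF F A) (isClosed_decompositionGroupNF F A) ⟨hct F A hA⟩
    (hslim F A hA)).centralizer_eq_bot

/-- **[AbsAnab] Thm 1.1.1 (ii) "In particular"**, global half, the printed deduction
kernel-checked via Remark 0.1.1 (`isSlimGroup_of_isRelativelySlim_subtype`, proved in
`ProfiniteTerminology.lean`): GIVEN the relative slimness of `G_𝔭 ↪ G_F` (named fact
`galoisNF_decomposition_relativelySlim`) and the existence of a nonarchimedean prime of `F̄`
(a valuation subring `A ≠ ⊤`; hypothesis `hex` — Chevalley's extension theorem, e.g. for a
`p`-adic valuation), `G_F` is slim. [cite: MochizukiAbsAnab2004, Thm 1.1.1 (ii) p.6] -/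
theorem galoisNF_slim_of_relativelySlim
    (hrs : galoisNF_decomposition_relativelySlim)
    (hex : ∀ (F : Type) [Field F] [NumberField F],
      ∃ A : ValuationSubring (AlgebraicClosure F), A ≠ ⊤) :
    galoisNF_slim := by
  intro F _ _
  obtain ⟨A, hA⟩ := hex F
  exact isSlimGroup_of_isRelativelySlim_subtype (decompositionGroupNF F A) ⟨hrs F A hA⟩

/-- Every field of characteristic zero has a "nonarchimedean prime" on its algebraic closure:
`F̄` carries a valuation subring `≠ ⊤` (Chevalley's extension theorem — Mathlib's
`Ideal.image_subset_nonunits_valuationSubring` — applied to the ideal `(2)` of `ℤ ⊆ F̄`).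
[folklore] -/
private theorem exists_valuationSubring_ne_top (F : Type) [Field F] [CharZero F] :
    ∃ A : ValuationSubring (AlgebraicClosure F), A ≠ ⊤ := by
  haveI : CharZero (AlgebraicClosure F) :=
    charZero_of_injective_algebraMap (algebraMap F (AlgebraicClosure F)).injective
  let R : Subring (AlgebraicClosure F) := (Int.castRingHom (AlgebraicClosure F)).range
  have h2R : (2 : AlgebraicClosure F) ∈ R := ⟨2, by simp⟩
  let I : Ideal R := Ideal.span {⟨2, h2R⟩}
  have hI : I ≠ ⊤ := by
    intro h
    have h1 : (1 : R) ∈ I := h ▸ Submodule.mem_top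
    obtain ⟨c, hc⟩ := Ideal.mem_span_singleton'.mp h1
    obtain ⟨m, hm⟩ := c.2
    have hval : (c : AlgebraicClosure F) * 2 = 1 := by
      have := congrArg Subtype.val hc
      simpa using this
    rw [← hm] at hval
    have hcast : ((m * 2 : ℤ) : AlgebraicClosure F) = ((1 : ℤ) : AlgebraicClosure F) := by
      push_cast
      exact hval
    have := Int.cast_injective hcast
    omega
  obtain ⟨B, -, hB⟩ := Ideal.image_subset_nonunits_valuationSubring I hI
  refine ⟨B, fun hB' => ?_⟩
  have h2 : (2 : AlgebraicClosure F) ∈ B.nonunits :=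
    hB ⟨⟨2, h2R⟩, Ideal.subset_span rfl, rfl⟩
  rcases B.mem_nonunits_iff_or.mp h2 with h0 | hnot
  · exact two_ne_zero h0
  · exact hnot (hB' ▸ ValuationSubring.mem_top _)

/-- **[AbsAnab] Thm 1.1.1 (ii) "In particular"**, global half: GIVEN the relative slimness of
`G_𝔭 ↪ G_F` (named fact `galoisNF_decomposition_relativelySlim`), `G_F` is slim — the
existence of a nonarchimedean prime being supplied by `exists_valuationSubring_ne_top`.
[cite: MochizukiAbsAnab2004, Thm 1.1.1 (ii) p.6] -/
theorem galoisNF_slim_of_decomposition_relativelySlim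
    (hrs : galoisNF_decomposition_relativelySlim) : galoisNF_slim :=
  galoisNF_slim_of_relativelySlim hrs fun F _ _ => exists_valuationSubring_ne_top F

end Thm111

end Literature.AnabelianGeometry.AbsoluteAnabelian
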